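import Literature.NumberTheory.LFunctions.RayClassLFunctionLocal
import Literature.NumberTheory.LFunctions.RayClassConductorUniqueness
import HarnessLib

/-!
# The entire `L`-function of an imprimitive ray class character: growth, Euler factors at the modulus,
# the real part of `−L'/L`, and reflection

Topic `Literature/NumberTheory/LFunctions`, namespace `Literature.NumberTheory.LFunctions`.
Everything here is PROVED (two definitions with bodies, theorems; no named facts).

For a ray class character `ψ mod 𝔪 ≠ 0`, non-principal on the primes `∤ 𝔪`, with primitive data `D`
(`χ₀ mod 𝔣`, entire `L`; `RayClassLFunctionLocal.lean`), the imprimitive `L`-function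
`L_𝔪(s, ψ) = L(s, χ₀) · ∏_{𝔭 ∣ 𝔪, 𝔭 ∤ 𝔣} (1 − χ₀(𝔭) N𝔭^{-s})` (Neukirch VII §8 before (8.5)) is entire as
well (`RayClassPrimitiveData.LMod`).  Uniformly in `K`, `𝔪`, `ψ`:
* `norm_L_le` — the convexity bound `|L(z)| ≤ |d_K| N𝔣 e^{2n} |z + 5/2|^n` for `Re z ≥ −1/2` transfers to the
  chosen `L` (uniqueness of the continuation);
* `norm_eulerCorr_le` — `|∏(1 − χ₀(𝔭)N𝔭^{-s})| ≤ N𝔪` for `Re s ≥ 0` (`2^{ω(𝔪)} ≤ N𝔪`); `norm_LMod_le` —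
  `|L_𝔪(s, ψ)| ≤ |d_K| N𝔪² e^{2n} (|t| + 6)^n` for `0 ≤ σ ≤ 3`;
* `norm_logDeriv_eulerProd_le` — `|P'/P(s)| ≤ log N𝔪` for `Re s > 1`, for any product `P` of Euler factors
  `1 − c_𝔭 N𝔭^{-s}` (`|c_𝔭| ≤ 1`) over prime divisors of `𝔪`;
* `re_neg_logDeriv_L_le` — `Re(−L'/L(s, χ₀)) ≤ 77760 ℳ(t)` for `1 < σ ≤ 2` (local partial fraction,
  `Re 1/(s − ρ) ≥ 0`; Thorner–Zaman 2019 Lemma 2.6 / Lagarias–Odlyzko Lemma 5.6);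
* `LMod_conj` — reflection `L_𝔪(conj s, ψ) = conj L_𝔪(s, ψ)` for a real character `ψ` (`ψ(𝔭) = ±1`).

## References
* [NeukirchANT1999] J. Neukirch, *Algebraic Number Theory*, Ch. VII §8, remark before (8.5).
* [LagariasOdlyzko1977] J. C. Lagarias, A. M. Odlyzko (1977), Lemmas 5.3, 5.6.
* [ThornerZaman2019] J. Thorner, A. Zaman, Algebra Number Theory 13 (2019), Lemma 2.6, Theorem 3.1.
-/

noncomputable section

open Complex Metric Set Filter Finset NumberField IsDedekindDomain
open scoped Real Topology NumberField ComplexConjugate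

namespace Literature.NumberTheory.LFunctions

open Literature.NumberTheory.LFunctions.LogFreeLocal
open scoped nonZeroDivisors Classical

variable {K : Type*} [Field K] [NumberField K] {𝔪 : Ideal (𝓞 K)} {ψ : HeightOneSpectrum (𝓞 K) → ℂ}

/-! ### Products of Euler factors at the prime divisors of `𝔪` -/

/-- The product of the norms of distinct prime divisors of `𝔪 ≠ 0` is at most `N𝔪`. [cite: NeukirchANT1999, Ch. VII §8 (8.1)] -/
private theorem prod_absNorm_le_of_dvd (h𝔪 : 𝔪 ≠ ⊥) {T : Finset (HeightOneSpectrum (𝓞 K))}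
    (hT : ∀ v ∈ T, v.asIdeal ∣ 𝔪) : ∏ v ∈ T, ((Ideal.absNorm v.asIdeal : ℕ) : ℝ) ≤ (Ideal.absNorm 𝔪 : ℕ) := by
  have hinf : (T.inf fun v ↦ v.asIdeal) = ∏ v ∈ T, v.asIdeal := by
    have h := IsDedekindDomain.inf_pow_eq_prod_of_prime T (fun v : HeightOneSpectrum (𝓞 K) ↦ v.asIdeal)
      (fun _ ↦ 1) (fun v _ ↦ v.prime) (fun v _ w _ hvw h ↦ hvw (HeightOneSpectrum.ext h))
    simpa only [pow_one] using h
  have hdvd : (∏ v ∈ T, v.asIdeal) ∣ 𝔪 := by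
    rw [← hinf, Ideal.dvd_iff_le, Finset.le_inf_iff]
    exact fun v hv ↦ Ideal.le_of_dvd (hT v hv)
  have hN : Ideal.absNorm (∏ v ∈ T, v.asIdeal) ∣ Ideal.absNorm 𝔪 := map_dvd Ideal.absNorm hdvd
  have hm0 : Ideal.absNorm 𝔪 ≠ 0 := by rwa [Ne, Ideal.absNorm_eq_zero_iff]
  have hle : Ideal.absNorm (∏ v ∈ T, v.asIdeal) ≤ Ideal.absNorm 𝔪 := Nat.le_of_dvd (Nat.pos_of_ne_zero hm0) hN
  rw [map_prod] at hle
  exact_mod_cast hle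

/-- **`|∏_{𝔭 ∈ T}(1 − c_𝔭 N𝔭^{-s})| ≤ N𝔪`** for `Re s ≥ 0`, `|c_𝔭| ≤ 1`, `T` a set of prime divisors of `𝔪 ≠ 0`
(each factor is `≤ 2 ≤ N𝔭`). [cite: NeukirchANT1999, Ch. VII §8 (8.1)] -/
theorem norm_eulerProd_le (h𝔪 : 𝔪 ≠ ⊥) {T : Finset (HeightOneSpectrum (𝓞 K))} (hT : ∀ v ∈ T, v.asIdeal ∣ 𝔪)
    {c : HeightOneSpectrum (𝓞 K) → ℂ} (hc : ∀ v ∈ T, ‖c v‖ ≤ 1) {s : ℂ} (hs : 0 ≤ s.re) :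
    ‖∏ v ∈ T, (1 - c v * ((Ideal.absNorm v.asIdeal : ℕ) : ℂ) ^ (-s))‖ ≤ (Ideal.absNorm 𝔪 : ℕ) := by
  refine (Finset.norm_prod_le _ _).trans ((Finset.prod_le_prod (fun v _ ↦ norm_nonneg _) fun v hv ↦ ?_).trans
    (prod_absNorm_le_of_dvd h𝔪 hT))
  have hN : 0 < Ideal.absNorm v.asIdeal := Nat.pos_of_ne_zero (by rw [Ne, Ideal.absNorm_eq_zero_iff]; exact v.ne_bot)
  have hN2' : 2 ≤ Ideal.absNorm v.asIdeal := AbelianDensity.two_le_absNorm K v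
  have hN2 : (2 : ℝ) ≤ (Ideal.absNorm v.asIdeal : ℕ) := by exact_mod_cast hN2'
  have hcpow : ‖((Ideal.absNorm v.asIdeal : ℕ) : ℂ) ^ (-s)‖ ≤ 1 := by
    rw [Complex.norm_natCast_cpow_of_pos hN, Complex.neg_re]
    exact Real.rpow_le_one_of_one_le_of_nonpos (by exact_mod_cast hN) (by linarith)
  calc ‖1 - c v * ((Ideal.absNorm v.asIdeal : ℕ) : ℂ) ^ (-s)‖
      ≤ ‖(1 : ℂ)‖ + ‖c v * ((Ideal.absNorm v.asIdeal : ℕ) : ℂ) ^ (-s)‖ := norm_sub_le _ _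
    _ = 1 + ‖c v‖ * ‖((Ideal.absNorm v.asIdeal : ℕ) : ℂ) ^ (-s)‖ := by rw [norm_one, norm_mul]
    _ ≤ 1 + 1 * 1 := by gcongr; exact hc v hv
    _ = 2 := by norm_num
    _ ≤ (Ideal.absNorm v.asIdeal : ℕ) := hN2

/-- The Euler factor `1 − c N𝔭^{-s}` is differentiable. [cite: NeukirchANT1999, Ch. VII §8 (8.1)] -/
theorem differentiable_eulerFactor (c : ℂ) (v : HeightOneSpectrum (𝓞 K)) :
    Differentiable ℂ (fun s : ℂ ↦ 1 - c * ((Ideal.absNorm v.asIdeal : ℕ) : ℂ) ^ (-s)) := by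
  have hN : ((Ideal.absNorm v.asIdeal : ℕ) : ℂ) ≠ 0 := by
    exact_mod_cast (Nat.pos_of_ne_zero (by rw [Ne, Ideal.absNorm_eq_zero_iff]; exact v.ne_bot)).ne'
  exact (differentiable_const _).sub ((differentiable_const _).mul
    fun z ↦ DifferentiableAt.const_cpow differentiable_neg.differentiableAt (Or.inl hN))

/-- The logarithmic derivative of an Euler factor: `|(1 − cN^{-s})'/(1 − cN^{-s})| ≤ log N` for `Re s > 1`,
`|c| ≤ 1` (`= |c log N · N^{-s}/(1 − cN^{-s})| ≤ log N · N^{-σ}/(1 − N^{-σ}) ≤ log N`). [cite: LagariasOdlyzko1977, Lemma 5.3] -/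
theorem norm_logDeriv_eulerFactor_le {c : ℂ} (hc : ‖c‖ ≤ 1) (v : HeightOneSpectrum (𝓞 K)) {s : ℂ} (hs : 1 < s.re) :
    ‖logDeriv (fun s : ℂ ↦ 1 - c * ((Ideal.absNorm v.asIdeal : ℕ) : ℂ) ^ (-s)) s‖ ≤
      Real.log (Ideal.absNorm v.asIdeal : ℕ) := by
  set N : ℕ := Ideal.absNorm v.asIdeal with hNdef
  have hNpos : 0 < N := Nat.pos_of_ne_zero (by rw [hNdef, Ne, Ideal.absNorm_eq_zero_iff]; exact v.ne_bot)
  have hN2 : (2 : ℝ) ≤ N := by exact_mod_cast AbelianDensity.two_le_absNorm K v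
  have hNC : (N : ℂ) ≠ 0 := by exact_mod_cast hNpos.ne'
  have hlogN : 0 ≤ Real.log (N : ℝ) := Real.log_natCast_nonneg N
  -- derivative
  have hder : HasDerivAt (fun s : ℂ ↦ 1 - c * (N : ℂ) ^ (-s)) (c * (Complex.log N * (N : ℂ) ^ (-s))) s := by
    have h1 : HasDerivAt (fun s : ℂ ↦ (N : ℂ) ^ (-s)) ((N : ℂ) ^ (-s) * Complex.log N * (-1)) s := by
      have := ((hasDerivAt_neg s).const_cpow (c := (N : ℂ)) (Or.inl hNC))
      simpa using this
    exact ((h1.const_mul c).const_sub 1).congr_deriv (by ring)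
  rw [logDeriv_apply, hder.deriv]
  have hq : ‖(N : ℂ) ^ (-s)‖ = (N : ℝ) ^ (-s.re) := by rw [Complex.norm_natCast_cpow_of_pos hNpos, Complex.neg_re]
  have hqle : (N : ℝ) ^ (-s.re) ≤ 1 / 2 := by
    calc (N : ℝ) ^ (-s.re) ≤ (N : ℝ) ^ (-1 : ℝ) :=
          Real.rpow_le_rpow_of_exponent_le (by exact_mod_cast hNpos) (by linarith)
      _ = 1 / N := by rw [Real.rpow_neg_one]; exact (one_div _).symm
      _ ≤ 1 / 2 := one_div_le_one_div_of_le (by norm_num) hN2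
  have hden : 1 / 2 ≤ ‖1 - c * (N : ℂ) ^ (-s)‖ := by
    have h1 : ‖c * (N : ℂ) ^ (-s)‖ ≤ 1 / 2 := by
      rw [norm_mul, hq]
      calc ‖c‖ * (N : ℝ) ^ (-s.re) ≤ 1 * (1 / 2) := mul_le_mul hc hqle (by positivity) zero_le_one
        _ = 1 / 2 := one_mul _
    have := norm_sub_norm_le (1 : ℂ) (c * (N : ℂ) ^ (-s))
    rw [norm_one] at this
    linarith
  have hlogC : ‖Complex.log (N : ℂ)‖ = Real.log N := by
    rw [show (N : ℂ) = ((N : ℝ) : ℂ) by norm_cast, ← Complex.ofReal_log (by positivity), Complex.norm_real,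
      Real.norm_eq_abs, abs_of_nonneg hlogN]
  rw [norm_div, norm_mul, norm_mul, hlogC, hq]
  rw [div_le_iff₀ (by linarith)]
  calc ‖c‖ * (Real.log N * (N : ℝ) ^ (-s.re)) ≤ 1 * (Real.log N * (1 / 2)) := by
        gcongr
    _ ≤ Real.log N * ‖1 - c * (N : ℂ) ^ (-s)‖ := by rw [one_mul]; exact mul_le_mul_of_nonneg_left hden hlogN

/-- **`|P'/P(s)| ≤ log N𝔪`** for `Re s > 1`, where `P(s) = ∏_{𝔭 ∈ T}(1 − c_𝔭 N𝔭^{-s})`, `|c_𝔭| ≤ 1`, `T` a set of prime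
divisors of `𝔪 ≠ 0` (`Σ_{𝔭∣𝔪} log N𝔭 ≤ log N𝔪`). [cite: LagariasOdlyzko1977, Lemma 5.3] -/
theorem norm_logDeriv_eulerProd_le (h𝔪 : 𝔪 ≠ ⊥) {T : Finset (HeightOneSpectrum (𝓞 K))}
    (hT : ∀ v ∈ T, v.asIdeal ∣ 𝔪) {c : HeightOneSpectrum (𝓞 K) → ℂ} (hc : ∀ v ∈ T, ‖c v‖ ≤ 1) {s : ℂ}
    (hs : 1 < s.re) :
    ‖logDeriv (fun s : ℂ ↦ ∏ v ∈ T, (1 - c v * ((Ideal.absNorm v.asIdeal : ℕ) : ℂ) ^ (-s))) s‖ ≤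
      Real.log (Ideal.absNorm 𝔪 : ℕ) := by
  rw [logDeriv_prod (fun v hv ↦ one_sub_mul_cpow_ne_zero (hc v hv) v hs)
    (fun v _ ↦ (differentiable_eulerFactor (c v) v).differentiableAt)]
  refine (norm_sum_le _ _).trans ?_
  calc ∑ v ∈ T, ‖logDeriv (fun s : ℂ ↦ 1 - c v * ((Ideal.absNorm v.asIdeal : ℕ) : ℂ) ^ (-s)) s‖
      ≤ ∑ v ∈ T, Real.log (Ideal.absNorm v.asIdeal : ℕ) := Finset.sum_le_sum fun v hv ↦ norm_logDeriv_eulerFactor_le (hc v hv) v hs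
    _ = Real.log (∏ v ∈ T, ((Ideal.absNorm v.asIdeal : ℕ) : ℝ)) := by
        rw [Real.log_prod]
        intro v _
        exact_mod_cast (Nat.pos_of_ne_zero (by rw [Ne, Ideal.absNorm_eq_zero_iff]; exact v.ne_bot)).ne'
    _ ≤ Real.log (Ideal.absNorm 𝔪 : ℕ) := by
        refine Real.log_le_log (Finset.prod_pos fun v _ ↦ ?_) (prod_absNorm_le_of_dvd h𝔪 hT)
        exact_mod_cast Nat.pos_of_ne_zero (by rw [Ne, Ideal.absNorm_eq_zero_iff]; exact v.ne_bot)

/-! ### The imprimitive `L`-function of the primitive data -/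

namespace RayClassPrimitiveData

variable (D : RayClassPrimitiveData 𝔪 ψ)

/-- The prime divisors of `𝔪` not dividing the conductor `𝔣`. [cite: NeukirchANT1999, Ch. VII §8 (8.1)] -/
def badPrimes : Finset (HeightOneSpectrum (𝓞 K)) :=
  (Ideal.finite_factors D.modulus_ne_bot).toFinset.filter (fun v ↦ ¬ D.𝔣 ≤ v.asIdeal)

/-- The bad primes divide `𝔪`. [cite: NeukirchANT1999, Ch. VII §8 (8.1)] -/
theorem dvd_of_mem_badPrimes {v : HeightOneSpectrum (𝓞 K)} (hv : v ∈ D.badPrimes) : v.asIdeal ∣ 𝔪 := by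
  rw [badPrimes, mem_filter, Set.Finite.mem_toFinset, Set.mem_setOf_eq] at hv; exact hv.1

/-- `|χ₀(𝔭)| ≤ 1` at the bad primes (`𝔭 ∤ 𝔣`). [cite: NeukirchANT1999, Ch. VII §8 (8.1)] -/
theorem norm_le_one_of_mem_badPrimes {v : HeightOneSpectrum (𝓞 K)} (hv : v ∈ D.badPrimes) : ‖D.χ₀ v‖ ≤ 1 := by
  rw [badPrimes, mem_filter] at hv; exact D.norm_le_one v hv.2

/-- The Euler correction `P(s) = ∏_{𝔭 ∣ 𝔪, 𝔭 ∤ 𝔣}(1 − χ₀(𝔭)N𝔭^{-s})`. [cite: NeukirchANT1999, Ch. VII §8 (8.1)] -/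
def eulerCorr (s : ℂ) : ℂ := ∏ v ∈ D.badPrimes, (1 - D.χ₀ v * ((Ideal.absNorm v.asIdeal : ℕ) : ℂ) ^ (-s))

/-- **The entire imprimitive `L`-function** `L_𝔪(s, ψ) = L(s, χ₀) · P(s)`. [cite: NeukirchANT1999, Ch. VII §8 Thm. (8.5)] -/
def LMod (s : ℂ) : ℂ := D.L s * D.eulerCorr s

/-- `P` is entire. [cite: NeukirchANT1999, Ch. VII §8 (8.1)] -/
theorem differentiable_eulerCorr : Differentiable ℂ D.eulerCorr := by
  rw [show D.eulerCorr = fun s ↦ ∏ v ∈ D.badPrimes, (1 - D.χ₀ v * ((Ideal.absNorm v.asIdeal : ℕ) : ℂ) ^ (-s)) from rfl]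
  exact Differentiable.fun_finsetProd fun v _ ↦ differentiable_eulerFactor (D.χ₀ v) v

/-- `L_𝔪(·, ψ)` is entire. [cite: NeukirchANT1999, Ch. VII §8 Thm. (8.5)] -/
theorem differentiable_LMod : Differentiable ℂ D.LMod := D.differentiable.mul D.differentiable_eulerCorr

/-- **`L_𝔪(s, ψ) = Σ_{(𝔞,𝔪)=1} ψ(𝔞) N𝔞^{-s}`** for `Re s > 1`. [cite: NeukirchANT1999, Ch. VII §8, remark before (8.5)] -/
theorem LMod_eq {s : ℂ} (hs : 1 < s.re) : D.LMod s = rayClassLSeries 𝔪 ψ s := by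
  rw [LMod, D.L_eq s hs, D.lseries_eq s hs]; rfl

/-- `P(s) ≠ 0` for `Re s > 1`. [cite: NeukirchANT1999, Ch. VII §8 (8.1)] -/
theorem eulerCorr_ne_zero {s : ℂ} (hs : 1 < s.re) : D.eulerCorr s ≠ 0 :=
  Finset.prod_ne_zero_iff.mpr fun v hv ↦ one_sub_mul_cpow_ne_zero (D.norm_le_one_of_mem_badPrimes hv) v hs

/-- `L_𝔪(s, ψ) ≠ 0` for `Re s ≥ 1` off... for `Re s > 1`, and on `Re s = 1` as well. [cite: ThornerZaman2017, Lemma 5.3] -/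
theorem LMod_ne_zero_of_one_lt_re (hnt : ∃ v : HeightOneSpectrum (𝓞 K), ¬ 𝔪 ≤ v.asIdeal ∧ ψ v ≠ 1)
    {s : ℂ} (hs : 1 < s.re) : D.LMod s ≠ 0 :=
  mul_ne_zero (D.L_ne_zero_of_one_le_re hnt hs.le) (D.eulerCorr_ne_zero hs)

/-- `|P(s)| ≤ N𝔪` for `Re s ≥ 0`. [cite: NeukirchANT1999, Ch. VII §8 (8.1)] -/
theorem norm_eulerCorr_le {s : ℂ} (hs : 0 ≤ s.re) : ‖D.eulerCorr s‖ ≤ (Ideal.absNorm 𝔪 : ℕ) :=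
  norm_eulerProd_le D.modulus_ne_bot (fun _ hv ↦ D.dvd_of_mem_badPrimes hv)
    (fun _ hv ↦ D.norm_le_one_of_mem_badPrimes hv) hs

/-- `|P'/P(s)| ≤ log N𝔪` for `Re s > 1`. [cite: LagariasOdlyzko1977, Lemma 5.3] -/
theorem norm_logDeriv_eulerCorr_le {s : ℂ} (hs : 1 < s.re) : ‖logDeriv D.eulerCorr s‖ ≤ Real.log (Ideal.absNorm 𝔪 : ℕ) :=
  norm_logDeriv_eulerProd_le D.modulus_ne_bot (fun _ hv ↦ D.dvd_of_mem_badPrimes hv)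
    (fun _ hv ↦ D.norm_le_one_of_mem_badPrimes hv) hs

/-- **The convexity bound for the chosen `L`**: `|L(z)| ≤ |d_K| N𝔣 e^{2n} |z + 5/2|^{n}` for `Re z ≥ −1/2`
(Rademacher; transferred by uniqueness of the entire continuation). [cite: ThornerZaman2019, Lemma 2.5] -/
theorem norm_L_le (hnt : ∃ v : HeightOneSpectrum (𝓞 K), ¬ 𝔪 ≤ v.asIdeal ∧ ψ v ≠ 1) {z : ℂ} (hz : -1 / 2 ≤ z.re) :
    ‖D.L z‖ ≤ (|(discr K : ℝ)| * (Ideal.absNorm D.𝔣 : ℝ)) * Real.exp (2 * Module.finrank ℚ K) *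
      ‖z + 5 / 2‖ ^ Module.finrank ℚ K := by
  obtain ⟨L', hL'd, hL's, hL'b⟩ := exists_continuation_norm_le D.isRayClassCharacter D.isPrimitive D.isSignType
    D.ne_bot (D.nontrivial hnt)
  have hLL : D.L = L' := by
    have h := AnalyticOnNhd.eqOn_of_preconnected_of_eventuallyEq (𝕜 := ℂ)
      (D.differentiable.differentiableOn.analyticOnNhd isOpen_univ) (hL'd.differentiableOn.analyticOnNhd isOpen_univ)
      isPreconnected_univ (Set.mem_univ (2 : ℂ)) ?_
    · exact funext fun s ↦ h (Set.mem_univ s)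
    · refine eventually_of_mem ((continuous_re.isOpen_preimage _ isOpen_Ioi).mem_nhds (by simp : 1 < (2 : ℂ).re))
        fun t (ht : 1 < t.re) ↦ ?_
      rw [D.L_eq t ht, hL's t ht]
  rw [hLL]; exact hL'b z hz

/-- **`|L_𝔪(s, ψ)| ≤ |d_K| N𝔪² e^{2n} (|t| + 6)^n`** for `0 ≤ σ ≤ 3`. [cite: ThornerZaman2019, Lemma 2.5] -/
theorem norm_LMod_le (hnt : ∃ v : HeightOneSpectrum (𝓞 K), ¬ 𝔪 ≤ v.asIdeal ∧ ψ v ≠ 1) {s : ℂ} (hs0 : 0 ≤ s.re)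
    (hs3 : s.re ≤ 3) :
    ‖D.LMod s‖ ≤ ((NumberField.discr K).natAbs : ℝ) * ((Ideal.absNorm 𝔪 : ℕ) : ℝ) ^ 2 *
      Real.exp (2 * Module.finrank ℚ K) * (|s.im| + 6) ^ Module.finrank ℚ K := by
  set n := Module.finrank ℚ K
  have hdisc : |(discr K : ℝ)| = ((NumberField.discr K).natAbs : ℝ) := by rw [Nat.cast_natAbs, Int.cast_abs]
  have h1 := D.norm_L_le hnt (z := s) (by linarith)
  rw [hdisc] at h1
  have h2 := D.norm_eulerCorr_le hs0
  have hz : ‖s + 5 / 2‖ ≤ |s.im| + 6 := by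
    calc ‖s + 5 / 2‖ ≤ |(s + 5 / 2).re| + |(s + 5 / 2).im| := Complex.norm_le_abs_re_add_abs_im _
      _ ≤ |s.im| + 6 := by
          simp only [add_re, add_im, div_ofNat_re, div_ofNat_im]
          norm_num
          rw [abs_of_nonneg (by linarith)]; linarith
  have hN𝔣 := D.absNorm_le
  have hN1 : (1 : ℝ) ≤ ((Ideal.absNorm 𝔪 : ℕ) : ℝ) := by
    exact_mod_cast Nat.one_le_iff_ne_zero.mpr (by rw [Ne, Ideal.absNorm_eq_zero_iff]; exact D.modulus_ne_bot)
  have hN𝔣' : (Ideal.absNorm D.𝔣 : ℝ) ≤ ((Ideal.absNorm 𝔪 : ℕ) : ℝ) := by exact_mod_cast hN𝔣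
  rw [LMod, norm_mul]
  calc ‖D.L s‖ * ‖D.eulerCorr s‖
      ≤ (((NumberField.discr K).natAbs : ℝ) * ((Ideal.absNorm 𝔪 : ℕ) : ℝ) * Real.exp (2 * n) * (|s.im| + 6) ^ n) *
          (Ideal.absNorm 𝔪 : ℕ) := by
        refine mul_le_mul (h1.trans ?_) h2 (norm_nonneg _) (by positivity)
        gcongr
    _ = _ := by ring

/-- **`Re(−L'/L(s, χ₀)) ≤ 77760 ℳ(t)`** for `1 < σ ≤ 2`: the local partial fraction with `Re 1/(s−ρ) ≥ 0` for all
zeros. [cite: ThornerZaman2019, Lemma 2.6] -/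
theorem re_neg_logDeriv_L_le (hnt : ∃ v : HeightOneSpectrum (𝓞 K), ¬ 𝔪 ≤ v.asIdeal ∧ ψ v ≠ 1) {s : ℂ}
    (hs : 1 < s.re) (hs2 : s.re ≤ 2) : (-logDeriv D.L s).re ≤ 77760 * rayDiscBound K 𝔪 s.im := by
  set t : ℝ := s.im with ht
  have hsc : s ∈ closedBall (2 + (t : ℂ) * I) (7 / 4) := by
    rw [mem_closedBall, dist_eq_norm]
    have : s - (2 + (t : ℂ) * I) = ((s.re - 2 : ℝ) : ℂ) := by apply Complex.ext <;> simp [ht]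
    rw [this, Complex.norm_real, Real.norm_eq_abs, abs_le]; constructor <;> linarith
  have hfs : D.L s ≠ 0 := D.L_ne_zero_of_one_le_re hnt hs.le
  have hpf := D.norm_logDeriv_sub_sum_le hnt t hsc hfs
  have hdf := D.differentiable
  have hfc := D.L_two_add_ne_zero hnt t
  set S := ∑ ρ ∈ discZeros D.L t, (discDivisor D.L t ρ : ℂ) / (s - ρ) with hS
  have hSnn : 0 ≤ S.re := by
    rw [hS, Complex.re_sum]
    refine Finset.sum_nonneg fun ρ hρ ↦ ?_
    have hmem := (mem_discZeros hdf hfc).1 hρ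
    have hρre : ρ.re < 1 := D.re_lt_one_of_zero hnt hmem.2
    have hm : (0 : ℝ) ≤ discDivisor D.L t ρ := by exact_mod_cast discDivisor_nonneg hdf t ρ
    rw [show ((discDivisor D.L t ρ : ℤ) : ℂ) = ((discDivisor D.L t ρ : ℝ) : ℂ) by simp, div_eq_mul_inv,
      Complex.re_ofReal_mul]
    refine mul_nonneg hm ?_
    rw [Complex.inv_re]
    exact div_nonneg (by simp; linarith) (Complex.normSq_nonneg _)
  have h1 : (-logDeriv D.L s).re ≤ -S.re + ‖logDeriv D.L s - S‖ := by
    have := Complex.abs_re_le_norm (logDeriv D.L s - S)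
    rw [Complex.sub_re] at this
    rw [Complex.neg_re]
    linarith [(abs_le.mp this).1]
  linarith

/-- **Reflection for a real character**: if `ψ(𝔭) = conj ψ(𝔭)` for all `𝔭 ∤ 𝔪`, then
`L_𝔪(conj s, ψ) = conj L_𝔪(s, ψ)`. [cite: ThornerZaman2019, Theorem 3.1] -/
theorem LMod_conj (hreal : ∀ v : HeightOneSpectrum (𝓞 K), ¬ 𝔪 ≤ v.asIdeal → conj (ψ v) = ψ v) (s : ℂ) :
    D.LMod (conj s) = conj (D.LMod s) := by
  have hψ1 : ∀ v : HeightOneSpectrum (𝓞 K), ¬ 𝔪 ≤ v.asIdeal → ‖ψ v‖ ≤ 1 := fun v hv ↦ by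
    rw [← D.agree v hv]; exact D.norm_le_one v (fun h ↦ hv (D.le.trans h))
  have hconj : ∀ z : ℂ, 1 < z.re → D.LMod z = rayClassLSeries 𝔪 (fun v ↦ conj (ψ v)) z := by
    intro z hz
    rw [D.LMod_eq hz]
    exact (rayClassLSeries_congr D.modulus_ne_bot (fun v hv ↦ (hreal v hv).symm) z)
  have h := rayClassLSeries_continuation_conj_eq D.modulus_ne_bot hψ1 D.differentiable_LMod (fun z hz ↦ D.LMod_eq hz)
    D.differentiable_LMod hconj (conj s)
  rw [Complex.conj_conj] at h
  exact h

end RayClassPrimitiveData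

end Literature.NumberTheory.LFunctions

end
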